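import Literature.IUT.HodgeTheaters.BaseHodgeTheaters
import HarnessLib

/-!
# Proofs for base-bridges and base-ΘNF-Hodge theaters, II: Proposition 4.8 (i), (ii) [Hodge theaters], (iii)
# ([IUTchI] p. 115) — abc-iut cell, layer L5 (discharge of `BaseHodgeTheaters.lean`)

Mochizuki, *Inter-universal Teichmüller theory I*, §4 (kurims May-2020 manuscript). The named Prop-valued statements
`Prop48i`, `Prop48iiHT`, `Prop48iii` of `BaseHodgeTheaters.lean` are PROVED for all `𝒟`-NF-bridges, `𝒟`-Θ-bridges and
`𝒟`-ΘNF-Hodge theaters over any `BaseThetaDatum` (print, p. 115: "follow immediately from the definitions"), by the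
transport-from-the-model argument of the printed proof of Prop. 4.7 made explicit:
* NORMAL FORMS: a constituent of `†φ^NF_j` at `v` is `δ ∘ d ∘ φ^NF_{•,v} ∘ α` (`α` an isomorphism to `𝒟_v`,
  `d ∈ Aut(𝒟^⊚)` of label `j`, `δ : 𝒟^⊚ ⥲ †𝒟^⊚` exhibiting; `mem_conj_phiNFj_iff`); pulling `δ(g·[ε])` back along it
  gives `(label(d)·g)·η` (`labPull_normalForm`), so the transported `φ^NF_j`, `j ∈ F_l^⋇`, are PAIRWISE DISTINCT
  (`eq_of_conj_phiNFj_eq`) — the content of "`Aut(C_K)/Aut_ε(C_K) ⥲ F_l^⋇`" (Ex. 4.3 (i)) the counts rest on;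
* RIGIDITY OF PRESENTATIONS: two families of model isomorphisms exhibiting one `𝒟`-NF-bridge index its capsule by
  bijections differing by a translation of `F_l^⋇` (`DNFBridge.presentation_unique`);
* MORPHISMS OF `𝒟`-NF-BRIDGES (Def. 4.6 (i)): the index bijection is a translation (`DNFBridge.Hom.ι_apply`), it
  determines the `Aut_ε`-orbit (`DNFBridge.Hom.ext_of_ι`), every translation occurs (`DNFBridge.Hom.exists_of_translate`).
Hence `prop48i_holds` (torsor: nonempty, determined by the index bijection, exactly `l^⋇`), `prop48iiHT_holds` (with
the uniqueness of isomorphisms of `𝒟`-Θ-bridges, `BaseHodgeTheaters.lean`), `prop48iii_holds` (exactly `l^⋇` gluings).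
Proof-only companion (no new definitions); record-only, [claim: Mochizuki2012, status: disputed]; nothing here takes a side.
-/

namespace Literature.IUT.HodgeTheaters

open CategoryTheory

universe u

namespace BaseThetaDatum

variable {𝔡 : BaseThetaDatum.{u}}

/-- The label of an automorphism of an isomorph of `𝒟^⊚` (Ex. 4.3 (i)) is invariant under conjugation by
isomorphisms `†𝒟^⊚ ⥲ ‡𝒟^⊚` (labels are read off the transported torsor). [claim: Mochizuki2012, status: disputed] -/
theorem autLabel_conj {Y Y' : 𝔡.AmbG} (e : Y ≅ Y') (d : Y ≅ Y) :
    autLabel (e.symm ≪≫ d ≪≫ e) = autLabel d := by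
  refine autLabel_eq_of_forall _ fun c => ?_
  rw [𝔡.labIsoG_trans, 𝔡.labIsoG_trans, labIsoG_symm, Equiv.symm_trans_apply, Equiv.symm_trans_apply,
    Equiv.symm_symm, labIsoG_symm_eq_autLabel_smul, 𝔡.labIsoG_smul, Equiv.apply_symm_apply]

/-- Conjugation invariance of labels, conjugating in the other direction. [claim: Mochizuki2012, status: disputed] -/
theorem autLabel_conj_symm {Y Y' : 𝔡.AmbG} (e : Y ≅ Y') (d : Y' ≅ Y') :
    autLabel (e ≪≫ d ≪≫ e.symm) = autLabel d := by
  have h := autLabel_conj e.symm d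
  rwa [Iso.symm_symm_eq] at h

/-- The inverse of a local `LabCusp`-transport is `F_l^⋇`-equivariant. [claim: Mochizuki2012, status: disputed] -/
theorem labIso_symm_smul {v : 𝔡.V} {X Y : 𝔡.Amb v} (a : X ≅ Y) (j : FlStar 𝔡.l) (c : 𝔡.LabCusp v Y) :
    (𝔡.labIso a).symm (j • c) = j • (𝔡.labIso a).symm c := by
  apply (𝔡.labIso a).injective
  rw [Equiv.apply_symm_apply, 𝔡.labIso_smul, Equiv.apply_symm_apply]

/-- The inverse of a local `LabCusp`-transport preserves `†η_v`. [claim: Mochizuki2012, status: disputed] -/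
theorem labIso_symm_η {v : 𝔡.V} {X Y : 𝔡.Amb v} (a : X ≅ Y) :
    (𝔡.labIso a).symm (𝔡.η v Y) = 𝔡.η v X := by
  rw [Equiv.symm_apply_eq, 𝔡.labIso_η]

/-! ### Labels of automorphisms; normal forms of the constituents of `†φ^NF_j` and the labels they carry -/

/-- **Label detection.** Pulling back the global class `e(g·[ε]) ∈ LabCusp(†𝒟^⊚)` along
`e ∘ d ∘ φ^NF_{•,v} ∘ α : X → †𝒟^⊚` (`α : X ⥲ 𝒟_v`, `d ∈ Aut(𝒟^⊚)`, `e : 𝒟^⊚ ⥲ †𝒟^⊚`) gives `(label(d)·g)·η_X`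
(Ex. 4.5 (i)–(ii): `Aut(𝒟^⊚)` acts on `LabCusp(𝒟^⊚)` through its label). [claim: Mochizuki2012, status: disputed] -/
theorem labPull_normalForm {v : 𝔡.V} {X : 𝔡.Amb v} {Y : 𝔡.AmbG} (α : X ≅ 𝔡.D v) (d : 𝔡.DG ≅ 𝔡.DG)
    (e : 𝔡.DG ≅ Y) (g : FlStar 𝔡.l) :
    𝔡.labPull (𝔡.postNF (𝔡.preNF α (𝔡.phiNF v)) (d ≪≫ e)) (𝔡.labIsoG e (g • 𝔡.εLab)) =
      (autLabel d * g) • 𝔡.η v X := by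
  rw [𝔡.labPull_postNF, 𝔡.labIsoG_trans, Equiv.symm_trans_apply, Equiv.symm_apply_apply,
    labIsoG_symm_eq_autLabel_smul, smul_smul, 𝔡.labPull_preNF, labPull_phiNF_eq, labIso_symm_smul,
    labIso_symm_η]

/-- **Normal form.** The transport `PolyHomNF.conj κ δ (φ^NF_j)` of the model `φ^NF_j` at `v` to isomorphs `X` of
`𝒟_v` (via `κ`) and `†𝒟^⊚` of `𝒟^⊚` (via `δ`) consists exactly of the `δ ∘ d ∘ φ^NF_{•,v} ∘ α`, `α : X ⥲ 𝒟_v`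
arbitrary, `d ∈ Aut(𝒟^⊚)` of label `j` (so it does not depend on `κ`). [claim: Mochizuki2012, status: disputed] -/
theorem mem_conj_phiNFj_iff {v : 𝔡.V} {X : 𝔡.Amb v} {Y : 𝔡.AmbG} (κ : 𝔡.D v ≅ X) (δ : 𝔡.DG ≅ Y)
    (j : FlStar 𝔡.l) (f : 𝔡.HomNF v X Y) :
    f ∈ PolyHomNF.conj 𝔡 κ δ (𝔡.phiNFj j v) ↔
      ∃ (α : X ≅ 𝔡.D v) (d : 𝔡.DG ≅ 𝔡.DG), autLabel d = j ∧
        f = 𝔡.postNF (𝔡.preNF α (𝔡.phiNF v)) (d ≪≫ δ) := by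
  constructor
  · rintro ⟨f₀, hf₀, rfl⟩
    obtain ⟨a, d, hd, rfl⟩ := (mem_phiNFj_iff f₀).1 hf₀
    refine ⟨κ.symm ≪≫ a, d, hd, ?_⟩
    rw [𝔡.preNF_postNF, ← 𝔡.postNF_trans, ← 𝔡.preNF_trans]
  · rintro ⟨α, d, hd, rfl⟩
    refine ⟨𝔡.postNF (𝔡.preNF (κ ≪≫ α) (𝔡.phiNF v)) d, (mem_phiNFj_iff _).2 ⟨κ ≪≫ α, d, hd, rfl⟩, ?_⟩
    rw [𝔡.preNF_postNF, ← 𝔡.postNF_trans, ← 𝔡.preNF_trans, Iso.symm_self_id_assoc]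

/-- The transported poly-morphism `φ^NF_j` does not depend on the isomorphism `κ` used on the source side (the model
`φ^NF_v` is saturated under `Aut(𝒟_v)`, Ex. 4.3 (ii)). [claim: Mochizuki2012, status: disputed] -/
theorem conj_phiNFj_eq_conj {v : 𝔡.V} {X : 𝔡.Amb v} {Y : 𝔡.AmbG} (κ κ' : 𝔡.D v ≅ X) (e : 𝔡.DG ≅ Y)
    (m : FlStar 𝔡.l) :
    PolyHomNF.conj 𝔡 κ e (𝔡.phiNFj m v) = PolyHomNF.conj 𝔡 κ' e (𝔡.phiNFj m v) := by
  ext f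
  rw [mem_conj_phiNFj_iff, mem_conj_phiNFj_iff]

/-- Post-composing the transported `φ^NF_j` with an `Aut_ε(†𝒟^⊚)`-orbit `Aut_ε(†𝒟^⊚) · δ` of isomorphisms
`†𝒟^⊚ ⥲ ‡𝒟^⊚` (Def. 4.6 (i), morphisms) transports it along `δ` — `Aut_ε` has label `1` ("`φ^NF_1` is stabilized
by the action of `Aut_ε(C_K)`", Ex. 4.3 (iv)). [claim: Mochizuki2012, status: disputed] -/
theorem conj_phiNFj_post_orbit {v : 𝔡.V} {X : 𝔡.Amb v} {Y Y' : 𝔡.AmbG} (κ : 𝔡.D v ≅ X)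
    (e : 𝔡.DG ≅ Y) (δ : Y ≅ Y') (m : FlStar 𝔡.l) :
    (PolyHomNF.conj 𝔡 κ e (𝔡.phiNFj m v)).post
        {δ' | ∃ β : Y ≅ Y, autLabel β = 1 ∧ δ' = β ≪≫ δ} =
      PolyHomNF.conj 𝔡 κ (e ≪≫ δ) (𝔡.phiNFj m v) := by
  ext f
  constructor
  · rintro ⟨f₀, hf₀, δ', ⟨β, hβ, rfl⟩, rfl⟩
    obtain ⟨α, d, hd, rfl⟩ := (mem_conj_phiNFj_iff κ e m f₀).1 hf₀
    refine (mem_conj_phiNFj_iff κ (e ≪≫ δ) m _).2 ⟨α, d ≪≫ (e ≪≫ β ≪≫ e.symm), ?_, ?_⟩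
    · rw [autLabel_trans, autLabel_conj_symm, hβ, hd, mul_one]
    · rw [← 𝔡.postNF_trans]
      simp only [Iso.trans_assoc, Iso.symm_self_id_assoc]
  · intro hf
    obtain ⟨α, d, hd, rfl⟩ := (mem_conj_phiNFj_iff κ (e ≪≫ δ) m f).1 hf
    exact ⟨𝔡.postNF (𝔡.preNF α (𝔡.phiNF v)) (d ≪≫ e), (mem_conj_phiNFj_iff κ e m _).2 ⟨α, d, hd, rfl⟩,
      Iso.refl Y ≪≫ δ, ⟨Iso.refl Y, autLabel_refl Y, rfl⟩,
      by rw [← 𝔡.postNF_trans, Iso.refl_trans, Iso.trans_assoc]⟩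

/-- Pre-composing the transported `φ^NF_j` (on an isomorph `X`) with ALL isomorphisms `X' ⥲ X` — the constituents of
a capsule-full poly-isomorphism at `v` (Def. 4.6 (i), morphisms) — gives the transported `φ^NF_j` on `X'`.
[claim: Mochizuki2012, status: disputed] -/
theorem pre_conj_phiNFj {v : 𝔡.V} {X X' : 𝔡.Amb v} {Y : 𝔡.AmbG} (κ : 𝔡.D v ≅ X) (κ' : 𝔡.D v ≅ X')
    (e : 𝔡.DG ≅ Y) (m : FlStar 𝔡.l) :
    {g : 𝔡.HomNF v X' Y | ∃ (a : X' ≅ X), ∃ f ∈ PolyHomNF.conj 𝔡 κ e (𝔡.phiNFj m v), g = 𝔡.preNF a f} =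
      PolyHomNF.conj 𝔡 κ' e (𝔡.phiNFj m v) := by
  ext g
  constructor
  · rintro ⟨a, f, hf, rfl⟩
    obtain ⟨α, d, hd, rfl⟩ := (mem_conj_phiNFj_iff κ e m f).1 hf
    exact (mem_conj_phiNFj_iff κ' e m _).2 ⟨a ≪≫ α, d, hd, by rw [𝔡.preNF_postNF, ← 𝔡.preNF_trans]⟩
  · intro hg
    obtain ⟨α, d, hd, rfl⟩ := (mem_conj_phiNFj_iff κ' e m g).1 hg
    refine ⟨κ'.symm ≪≫ κ, 𝔡.postNF (𝔡.preNF ((κ'.symm ≪≫ κ).symm ≪≫ α) (𝔡.phiNF v)) (d ≪≫ e),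
      (mem_conj_phiNFj_iff κ e m _).2 ⟨_, d, hd, rfl⟩, ?_⟩
    rw [𝔡.preNF_postNF, ← 𝔡.preNF_trans, Iso.self_symm_id_assoc]

/-- Changing the exhibiting isomorphism `e : 𝒟^⊚ ⥲ †𝒟^⊚` by `u ∈ Aut(𝒟^⊚)` relabels: the transport of `φ^NF_j` along
`e ∘ u` is the transport of `φ^NF_{j·label(u)}` along `e` (Ex. 4.3 (iv): "`φ^NF_j` is obtained from `φ^NF_1` by
post-composing with the poly-action of `j`"). [claim: Mochizuki2012, status: disputed] -/
theorem conj_trans_phiNFj {v : 𝔡.V} {X : 𝔡.Amb v} {Y : 𝔡.AmbG} (κ : 𝔡.D v ≅ X) (u : 𝔡.DG ≅ 𝔡.DG)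
    (e : 𝔡.DG ≅ Y) (m : FlStar 𝔡.l) :
    PolyHomNF.conj 𝔡 κ (u ≪≫ e) (𝔡.phiNFj m v) = PolyHomNF.conj 𝔡 κ e (𝔡.phiNFj (m * autLabel u) v) := by
  ext f
  rw [mem_conj_phiNFj_iff, mem_conj_phiNFj_iff]
  constructor
  · rintro ⟨α, d, hd, rfl⟩
    exact ⟨α, d ≪≫ u, by rw [autLabel_trans, hd], by rw [Iso.trans_assoc]⟩
  · rintro ⟨α, d, hd, rfl⟩
    refine ⟨α, d ≪≫ u.symm, ?_, ?_⟩
    · rw [autLabel_trans, autLabel_symm, hd, mul_inv_cancel_right]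
    · rw [Iso.trans_assoc, Iso.symm_self_id_assoc]

/-- **Distinct labels give distinct poly-morphisms**: if the transports of `φ^NF_m`, `φ^NF_{m'}` to the same isomorphs
along the same `e` coincide then `m = m'` (pull back `e([ε])`, `labPull_normalForm`) — this is where
"`Aut(C_K)/Aut_ε(C_K) ⥲ F_l^⋇`" (Ex. 4.3 (i)) enters the counts of Prop. 4.8. [claim: Mochizuki2012, status: disputed] -/
theorem eq_of_conj_phiNFj_eq {v : 𝔡.V} {X : 𝔡.Amb v} {Y : 𝔡.AmbG} (κ κ' : 𝔡.D v ≅ X) (e : 𝔡.DG ≅ Y)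
    {m m' : FlStar 𝔡.l}
    (h : PolyHomNF.conj 𝔡 κ e (𝔡.phiNFj m v) = PolyHomNF.conj 𝔡 κ' e (𝔡.phiNFj m' v)) : m = m' := by
  obtain ⟨d, hd⟩ : ∃ d : 𝔡.DG ≅ 𝔡.DG, autLabel d = m := autLabelHom_surjective 𝔡.DG m
  have hf : 𝔡.postNF (𝔡.preNF κ.symm (𝔡.phiNF v)) (d ≪≫ e) ∈ PolyHomNF.conj 𝔡 κ e (𝔡.phiNFj m v) :=
    (mem_conj_phiNFj_iff κ e m _).2 ⟨κ.symm, d, hd, rfl⟩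
  rw [h, mem_conj_phiNFj_iff] at hf
  obtain ⟨α, d', hd', hαd'⟩ := hf
  have key := labPull_normalForm κ.symm d e 1
  rw [hαd', labPull_normalForm, mul_one, mul_one, hd, hd'] at key
  have := congrArg ((𝔡.isTorsor_labCusp v X).labelEquiv (𝔡.η v X)) key
  rw [IsTorsor.labelEquiv_smul_self, IsTorsor.labelEquiv_smul_self] at this
  exact this.symm

/-! ### Presentations of a `𝒟`-NF-bridge by model isomorphisms -/

/-- In a `𝒟`-NF-bridge exhibited through model isomorphisms `(ι, κ, δ)` (Def. 4.6 (i)), the poly-morphism `†φ^NF_j`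
at `v` is the transport along `δ` of the model `φ^NF_{ι⁻¹(j)}` — read off through ANY isomorphism `𝒟_v ⥲ †𝒟_{j,v}`.
[claim: Mochizuki2012, status: disputed] -/
theorem DNFBridge.poly_eq_conj (B : 𝔡.DNFBridge) {ι : FlStar 𝔡.l ≃ B.J}
    {κ : ∀ j, 𝔡.tautStrip ≅ B.capsule (ι j)} {δ : 𝔡.DG ≅ B.glob}
    (h : ∀ j v, B.poly (ι j) v = PolyHomNF.conj 𝔡 (Pi.isoApp (κ j) v) δ (𝔡.phiNFj j v))
    (j : B.J) (v : 𝔡.V) (κ' : 𝔡.D v ≅ B.capsule j v) :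
    B.poly j v = PolyHomNF.conj 𝔡 κ' δ (𝔡.phiNFj (ι.symm j) v) := by
  obtain ⟨j₀, rfl⟩ : ∃ j₀, j = ι j₀ := ⟨ι.symm j, (ι.apply_symm_apply j).symm⟩
  rw [h, Equiv.symm_apply_apply]
  exact conj_phiNFj_eq_conj _ _ _ _

/-- **Rigidity of presentations**: two families of model isomorphisms `(ι, κ, δ)`, `(ι', κ', δ')` exhibiting the same
`𝒟`-NF-bridge index its capsule by bijections differing by the translation of `F_l^⋇` by the label of `δ' ∘ δ⁻¹`
(the `F_l^⋇`-indeterminacy of Props. 4.8–4.9). [claim: Mochizuki2012, status: disputed] -/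
theorem DNFBridge.presentation_unique (B : 𝔡.DNFBridge) {ι ι' : FlStar 𝔡.l ≃ B.J}
    {κ : ∀ j, 𝔡.tautStrip ≅ B.capsule (ι j)} {κ' : ∀ j, 𝔡.tautStrip ≅ B.capsule (ι' j)}
    {δ δ' : 𝔡.DG ≅ B.glob}
    (h : ∀ j v, B.poly (ι j) v = PolyHomNF.conj 𝔡 (Pi.isoApp (κ j) v) δ (𝔡.phiNFj j v))
    (h' : ∀ j v, B.poly (ι' j) v = PolyHomNF.conj 𝔡 (Pi.isoApp (κ' j) v) δ' (𝔡.phiNFj j v))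
    (j : FlStar 𝔡.l) : ι' j = ι (j * autLabel (δ' ≪≫ δ.symm)) := by
  obtain ⟨v, -⟩ := 𝔡.exists_isBad
  apply ι.symm.injective
  rw [Equiv.symm_apply_apply]
  have e1 := B.poly_eq_conj h (ι' j) v (Pi.isoApp (κ' j) v)
  have e2 := h' j v
  have hδ : δ' = (δ' ≪≫ δ.symm) ≪≫ δ := by
    rw [Iso.trans_assoc, Iso.symm_self_id, Iso.trans_refl]
  rw [e1, hδ, conj_trans_phiNFj] at e2
  exact eq_of_conj_phiNFj_eq _ _ _ e2

/-! ### Morphisms of `𝒟`-NF-bridges (Definition 4.6 (i)) relative to presentations -/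

/-- **The index bijection of a morphism of `𝒟`-NF-bridges is a translation**: relative to presentations `(ι, κ, δ)`
of the source and `(ι', κ', δ')` of the target, a morphism with `Aut_ε`-orbit `Aut_ε(†𝒟^⊚) · δ_φ` maps
`ι(j) ↦ ι'(j · t)`, `t` the label of `δ'⁻¹ ∘ δ_φ ∘ δ ∈ Aut(𝒟^⊚)`. [claim: Mochizuki2012, status: disputed] -/
theorem DNFBridge.Hom.ι_apply {B B' : 𝔡.DNFBridge} (φ : DNFBridge.Hom 𝔡 B B')
    {ι : FlStar 𝔡.l ≃ B.J} {κ : ∀ j, 𝔡.tautStrip ≅ B.capsule (ι j)} {δ : 𝔡.DG ≅ B.glob}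
    (h : ∀ j v, B.poly (ι j) v = PolyHomNF.conj 𝔡 (Pi.isoApp (κ j) v) δ (𝔡.phiNFj j v))
    {ι' : FlStar 𝔡.l ≃ B'.J} {κ' : ∀ j, 𝔡.tautStrip ≅ B'.capsule (ι' j)} {δ' : 𝔡.DG ≅ B'.glob}
    (h' : ∀ j v, B'.poly (ι' j) v = PolyHomNF.conj 𝔡 (Pi.isoApp (κ' j) v) δ' (𝔡.phiNFj j v))
    {δφ : B.glob ≅ B'.glob}
    (hO : φ.orbit = {δ'' | ∃ β : B.glob ≅ B.glob, autLabel β = 1 ∧ δ'' = β ≪≫ δφ}) (j : FlStar 𝔡.l) :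
    φ.ι (ι j) = ι' (j * autLabel (δ ≪≫ δφ ≪≫ δ'.symm)) := by
  obtain ⟨v, -⟩ := 𝔡.exists_isBad
  obtain ⟨κ''⟩ := 𝔡.nonempty_iso v (𝔡.D v) (B'.capsule (φ.ι (ι j)) v)
  have hc := φ.comm (ι j) v
  rw [h j v, hO, conj_phiNFj_post_orbit, B'.poly_eq_conj h' (φ.ι (ι j)) v κ'',
    pre_conj_phiNFj κ'' (Pi.isoApp (κ j) v) δ' (ι'.symm (φ.ι (ι j)))] at hc
  have hu : δ ≪≫ δφ = (δ ≪≫ δφ ≪≫ δ'.symm) ≪≫ δ' := by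
    simp only [Iso.trans_assoc, Iso.symm_self_id, Iso.trans_refl]
  rw [hu, conj_trans_phiNFj] at hc
  rw [eq_of_conj_phiNFj_eq _ _ _ hc, Equiv.apply_symm_apply]

/-- A morphism of `𝒟`-NF-bridges is determined by its index bijection and its `Aut_ε`-orbit (the two DATA of
Def. 4.6 (i); the compatibilities are properties). [claim: Mochizuki2012, status: disputed] -/
theorem DNFBridge.Hom.ext' {B B' : 𝔡.DNFBridge} {φ ψ : DNFBridge.Hom 𝔡 B B'} (h1 : φ.ι = ψ.ι)
    (h2 : φ.orbit = ψ.orbit) : φ = ψ := by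
  cases φ; cases ψ; cases h1; cases h2; rfl

/-- The `Aut_ε(†𝒟^⊚)`-orbit of `δ' ∘ u ∘ δ⁻¹ : †𝒟^⊚ ⥲ ‡𝒟^⊚` (`δ`, `δ'` exhibiting isomorphisms from `𝒟^⊚`,
`u ∈ Aut(𝒟^⊚)`) consists of the `δ' ∘ u' ∘ δ⁻¹` with `label(u') = label(u)`: the orbit remembers only the label
of `u`. [claim: Mochizuki2012, status: disputed] -/
theorem autEpsOrbit_eq {Y Y' : 𝔡.AmbG} (δ : 𝔡.DG ≅ Y) (δ' : 𝔡.DG ≅ Y') (u : 𝔡.DG ≅ 𝔡.DG) :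
    {δ'' : Y ≅ Y' | ∃ β : Y ≅ Y, autLabel β = 1 ∧ δ'' = β ≪≫ (δ.symm ≪≫ u ≪≫ δ')} =
      {δ'' | ∃ u' : 𝔡.DG ≅ 𝔡.DG, autLabel u' = autLabel u ∧ δ'' = δ.symm ≪≫ u' ≪≫ δ'} := by
  ext δ''
  constructor
  · rintro ⟨β, hβ, rfl⟩
    refine ⟨(δ ≪≫ β ≪≫ δ.symm) ≪≫ u, ?_, ?_⟩
    · rw [autLabel_trans, autLabel_conj_symm, hβ, one_mul]
    · simp only [Iso.trans_assoc, Iso.symm_self_id_assoc]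
  · rintro ⟨u', hu', rfl⟩
    refine ⟨δ.symm ≪≫ (u' ≪≫ u.symm) ≪≫ δ, ?_, ?_⟩
    · rw [autLabel_conj, autLabel_trans, autLabel_symm, hu', mul_inv_cancel]
    · simp only [Iso.trans_assoc, Iso.self_symm_id_assoc, Iso.symm_self_id_assoc]

/-- **Uniqueness** (Prop. 4.8 (i): an isomorphism is determined by its index bijection): two morphisms of
`𝒟`-NF-bridges with the same bijection of index sets are equal — the `Aut_ε`-orbit is forced by the compatibility
with `†φ^NF_⋆`, `‡φ^NF_⋆`. [claim: Mochizuki2012, status: disputed] -/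
theorem DNFBridge.Hom.ext_of_ι {B B' : 𝔡.DNFBridge} (φ ψ : DNFBridge.Hom 𝔡 B B') (hι : φ.ι = ψ.ι) : φ = ψ := by
  obtain ⟨ι, κ, δ, h⟩ := B.isModel
  obtain ⟨ι', κ', δ', h'⟩ := B'.isModel
  obtain ⟨δφ, hφ⟩ := φ.isOrbit
  obtain ⟨δψ, hψ⟩ := ψ.isOrbit
  have tφ := φ.ι_apply h h' hφ 1
  have tψ := ψ.ι_apply h h' hψ 1
  rw [one_mul] at tφ tψ
  rw [hι, tψ] at tφ
  have ht : autLabel (δ ≪≫ δψ ≪≫ δ'.symm) = autLabel (δ ≪≫ δφ ≪≫ δ'.symm) := ι'.injective tφ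
  refine DNFBridge.Hom.ext' hι ?_
  have eφ : δφ = δ.symm ≪≫ (δ ≪≫ δφ ≪≫ δ'.symm) ≪≫ δ' := by
    simp only [Iso.trans_assoc, Iso.symm_self_id_assoc, Iso.symm_self_id, Iso.trans_refl]
  have eψ : δψ = δ.symm ≪≫ (δ ≪≫ δψ ≪≫ δ'.symm) ≪≫ δ' := by
    simp only [Iso.trans_assoc, Iso.symm_self_id_assoc, Iso.symm_self_id, Iso.trans_refl]
  rw [hφ, hψ, eφ, eψ, autEpsOrbit_eq, autEpsOrbit_eq, ht]

/-- **Existence** (Prop. 4.8 (i): every translation occurs): for presentations `(ι, κ, δ)`, `(ι', κ', δ')` of two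
`𝒟`-NF-bridges and `t ∈ F_l^⋇`, the bijection `ι(j) ↦ ι'(j · t)` underlies a morphism of `𝒟`-NF-bridges, with
`Aut_ε`-orbit `δ' ∘ Aut_t(𝒟^⊚) ∘ δ⁻¹` (automorphisms of label `t`). [claim: Mochizuki2012, status: disputed] -/
theorem DNFBridge.Hom.exists_of_translate {B B' : 𝔡.DNFBridge}
    {ι : FlStar 𝔡.l ≃ B.J} {κ : ∀ j, 𝔡.tautStrip ≅ B.capsule (ι j)} {δ : 𝔡.DG ≅ B.glob}
    (h : ∀ j v, B.poly (ι j) v = PolyHomNF.conj 𝔡 (Pi.isoApp (κ j) v) δ (𝔡.phiNFj j v))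
    {ι' : FlStar 𝔡.l ≃ B'.J} {κ' : ∀ j, 𝔡.tautStrip ≅ B'.capsule (ι' j)} {δ' : 𝔡.DG ≅ B'.glob}
    (h' : ∀ j v, B'.poly (ι' j) v = PolyHomNF.conj 𝔡 (Pi.isoApp (κ' j) v) δ' (𝔡.phiNFj j v))
    (t : FlStar 𝔡.l) (g : B.J ≃ B'.J) (hg : ∀ j, g (ι j) = ι' (j * t)) :
    ∃ φ : DNFBridge.Hom 𝔡 B B', φ.ι = g := by
  obtain ⟨u, hu⟩ : ∃ u : 𝔡.DG ≅ 𝔡.DG, autLabel u = t := autLabelHom_surjective 𝔡.DG t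
  refine ⟨⟨g, {δ'' | ∃ β : B.glob ≅ B.glob, autLabel β = 1 ∧ δ'' = β ≪≫ (δ.symm ≪≫ u ≪≫ δ')}, ⟨_, rfl⟩,
    fun j v => ?_⟩, rfl⟩
  obtain ⟨κ₁⟩ := 𝔡.nonempty_iso v (𝔡.D v) (B.capsule j v)
  obtain ⟨κ₂⟩ := 𝔡.nonempty_iso v (𝔡.D v) (B'.capsule (g j) v)
  have hj : ι'.symm (g j) = ι.symm j * t := by
    rw [Equiv.symm_apply_eq, ← hg, Equiv.apply_symm_apply]
  rw [B.poly_eq_conj h j v κ₁, conj_phiNFj_post_orbit, Iso.self_symm_id_assoc, conj_trans_phiNFj, hu,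
    B'.poly_eq_conj h' (g j) v κ₂, pre_conj_phiNFj κ₂ κ₁ δ' (ι'.symm (g j)), hj]

/-- **The index bijections that occur** are exactly the `l^⋇` translations: the set of `ι(j) ↦ ι'(j·t)`, `t ∈ F_l^⋇`.
[claim: Mochizuki2012, status: disputed] -/
theorem DNFBridge.Hom.setOf_ι_eq_range {B B' : 𝔡.DNFBridge}
    {ι : FlStar 𝔡.l ≃ B.J} {κ : ∀ j, 𝔡.tautStrip ≅ B.capsule (ι j)} {δ : 𝔡.DG ≅ B.glob}
    (h : ∀ j v, B.poly (ι j) v = PolyHomNF.conj 𝔡 (Pi.isoApp (κ j) v) δ (𝔡.phiNFj j v))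
    {ι' : FlStar 𝔡.l ≃ B'.J} {κ' : ∀ j, 𝔡.tautStrip ≅ B'.capsule (ι' j)} {δ' : 𝔡.DG ≅ B'.glob}
    (h' : ∀ j v, B'.poly (ι' j) v = PolyHomNF.conj 𝔡 (Pi.isoApp (κ' j) v) δ' (𝔡.phiNFj j v)) :
    {g : B.J ≃ B'.J | ∃ φ : DNFBridge.Hom 𝔡 B B', φ.ι = g} =
      Set.range fun t : FlStar 𝔡.l => ι.symm.trans ((Equiv.mulRight t).trans ι') := by
  ext g
  constructor
  · rintro ⟨φ, rfl⟩
    obtain ⟨δφ, hφ⟩ := φ.isOrbit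
    refine ⟨autLabel (δ ≪≫ δφ ≪≫ δ'.symm), Equiv.ext fun j => ?_⟩
    obtain ⟨j₀, rfl⟩ : ∃ j₀, j = ι j₀ := ⟨ι.symm j, (ι.apply_symm_apply j).symm⟩
    rw [φ.ι_apply h h' hφ j₀]
    simp
  · rintro ⟨t, rfl⟩
    exact DNFBridge.Hom.exists_of_translate h h' t _ fun j => by simp

/-! ### Proposition 4.8 (i), (ii) [Hodge theaters], (iii) -/

/-- **Proposition 4.8 (i) holds** ([IUTchI] p. 115): for any two `𝒟`-NF-bridges, "the set of isomorphisms between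
[them] forms an `F_l^⋇`-torsor" — nonempty, an isomorphism is determined by its bijection of index sets, and exactly
`l^⋇` bijections occur (the translations, relative to any presentations). [claim: Mochizuki2012, status: disputed] -/
theorem prop48i_holds (B B' : 𝔡.DNFBridge) : Prop48i B B' := by
  obtain ⟨ι, κ, δ, h⟩ := B.isModel
  obtain ⟨ι', κ', δ', h'⟩ := B'.isModel
  refine ⟨?_, fun φ ψ => DNFBridge.Hom.ext_of_ι φ ψ, ?_⟩
  · obtain ⟨φ, -⟩ := DNFBridge.Hom.exists_of_translate h h' 1 (ι.symm.trans ι') fun j => by simp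
    exact ⟨φ⟩
  · have hinj : Function.Injective fun t : FlStar 𝔡.l => ι.symm.trans ((Equiv.mulRight t).trans ι') := by
      intro t t' htt'
      have := Equiv.congr_fun htt' (ι 1)
      simpa using this
    change Nat.card ↥{g : B.J ≃ B'.J | ∃ φ : DNFBridge.Hom 𝔡 B B', φ.ι = g} = _
    rw [DNFBridge.Hom.setOf_ι_eq_range h h', ← Nat.card_congr (Equiv.ofInjective _ hinj),
      card_flStar 𝔡.l 𝔡.l_ne_two]

/-- In a `𝒟`-Θ-bridge exhibited through model isomorphisms indexed by `ι`, the labels of Prop. 4.7 (i) are `†χ = ι⁻¹`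
(= `DThetaBridge.χ_apply_of_isModel` of `BaseHodgeTheatersProofs.lean`, repeated privately so that this file does
not import that one). [claim: Mochizuki2012, status: disputed] -/
private theorem χ_apply_of_isModel_aux (B : 𝔡.DThetaBridge) (ι : FlStar 𝔡.l ≃ B.J)
    (κ : ∀ j, 𝔡.tautStrip ≅ B.capsule (ι j)) (γ : 𝔡.tautStrip ≅ B.cod)
    (hΘ : ∀ j v, B.poly (ι j) v =
      {g | ∃ f ∈ 𝔡.modelThetaBridge j v, g = (Pi.isoApp (κ j) v).inv ≫ f ≫ (Pi.isoApp γ v).hom})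
    (j : FlStar 𝔡.l) : B.χ (ι j) = j := by
  obtain ⟨v, hv⟩ := 𝔡.exists_isBad
  have h := B.χ_unique hv (fun i => ι.symm i) (fun i f hf => by
    obtain ⟨j', rfl⟩ : ∃ j', i = ι j' := ⟨ι.symm i, by simp⟩
    rw [hΘ j' v] at hf
    obtain ⟨f₀, hf₀, rfl⟩ := hf
    rw [Equiv.symm_apply_apply]
    exact phiThetaAt_isoComp j' (Pi.isoApp (κ j') v).symm (phiThetaAt_compIso j' (Pi.isoApp γ v) hf₀))
  have := congrFun h (ι j)
  rw [Equiv.symm_apply_apply] at this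
  exact this.symm

/-- **Proposition 4.8 (ii) holds for `𝒟`-ΘNF-Hodge theaters** ([IUTchI] p. 115): "the set of isomorphisms between
two `𝒟`-ΘNF-Hodge theaters is of cardinality one" — the unique (label-preserving) isomorphism of the underlying
`𝒟`-Θ-bridges pairs with the morphism of underlying `𝒟`-NF-bridges with the same index bijection; both components
are unique. [claim: Mochizuki2012, status: disputed] -/
theorem prop48iiHT_holds (H H' : 𝔡.DThetaNFHodgeTheater) : Prop48iiHT H H' := by
  obtain ⟨ι, κ, δ, γ, hNF, hΘ⟩ := H.isModel
  obtain ⟨ι', κ', δ', γ', hNF', hΘ'⟩ := H'.isModel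
  have hχ : ∀ j, H.toDThetaBridge.χ (ι j) = j := χ_apply_of_isModel_aux H.toDThetaBridge ι κ γ hΘ
  have hχ' : ∀ j, H'.toDThetaBridge.χ (ι' j) = j := χ_apply_of_isModel_aux H'.toDThetaBridge ι' κ' γ' hΘ'
  constructor
  · obtain ⟨θ⟩ := DThetaBridge.Hom.nonempty H.toDThetaBridge H'.toDThetaBridge
    obtain ⟨φ, hφ⟩ := DNFBridge.Hom.exists_of_translate (B := H.toDNFBridge) (B' := H'.toDNFBridge)
      (ι := ι) (κ := κ) (δ := δ) hNF (ι' := ι') (κ' := κ') (δ' := δ') hNF' 1 θ.ι fun j => by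
        rw [mul_one]
        apply H'.toDThetaBridge.χ.injective
        exact (θ.χ_comp (ι j)).trans ((hχ j).trans (hχ' j).symm)
    exact ⟨⟨φ, θ, hφ⟩⟩
  · refine ⟨fun Φ Ψ => ?_⟩
    have hθ : Φ.theta = Ψ.theta := (DThetaBridge.Hom.subsingleton _ _).elim _ _
    have hnf : Φ.nf = Ψ.nf := DNFBridge.Hom.ext_of_ι _ _ (by rw [Φ.compat, Ψ.compat, hθ])
    cases Φ; cases Ψ; cases hθ; cases hnf; rfl

/-- **Proposition 4.8 (iii) holds** ([IUTchI] p. 115): given a `𝒟`-NF-bridge and a `𝒟`-Θ-bridge, the gluing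
bijections `J_NF ⥲ J_Θ` (under which the labels `†χ` of the Θ-bridge match some model indexing of the NF-bridge up
to a translation) "form an `F_l^⋇`-torsor": exactly `l^⋇` of them — by rigidity of presentations they are
`†χ⁻¹ ∘ (s · –) ∘ ι⁻¹`, `s ∈ F_l^⋇`, for any one presentation `ι`. [claim: Mochizuki2012, status: disputed] -/
theorem prop48iii_holds (B : 𝔡.DNFBridge) (T : 𝔡.DThetaBridge) : Prop48iii B T := by
  obtain ⟨ι, κ, δ, h⟩ := B.isModel
  unfold Prop48iii
  refine (Nat.card_congr (Equiv.ofBijective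
    (fun s : FlStar 𝔡.l => ⟨ι.symm.trans ((Equiv.mulLeft s).trans T.χ.symm), ι, κ, δ, h, s, fun j => by simp⟩)
    ⟨fun s s' hss' => ?_, ?_⟩)).symm.trans (card_flStar 𝔡.l 𝔡.l_ne_two)
  · have := Equiv.congr_fun (congrArg Subtype.val hss') (ι 1)
    simpa using this
  · rintro ⟨g, ι₁, κ₁, δ₁, h₁, t, ht⟩
    refine ⟨t * (autLabel (δ₁ ≪≫ δ.symm))⁻¹, Subtype.ext (Equiv.ext fun j => ?_)⟩
    obtain ⟨j₀, rfl⟩ : ∃ j₀, j = ι j₀ := ⟨ι.symm j, (ι.apply_symm_apply j).symm⟩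
    have key := ht (j₀ * (autLabel (δ₁ ≪≫ δ.symm))⁻¹)
    rw [B.presentation_unique h h₁, inv_mul_cancel_right] at key
    simp only [Equiv.trans_apply, Equiv.symm_apply_apply, Equiv.coe_mulLeft, Equiv.symm_apply_eq, key]
    rw [mul_assoc, mul_comm j₀]

end BaseThetaDatum

end Literature.IUT.HodgeTheaters
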